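import Summits.CriticalPhenomena.PercolationContinuityZ3.Theorems.Transplant.FKConnectivityAllQForestTreeLevelSteps
import HarnessLib

/-!
# THE TREE LEVEL of the square-free adjacent forest Rayleigh node: the node's inequality holds on every TIGHT fibre
# (Cibulka–Hladký–LaCroix–Wagner's coefficientwise Rayleigh monotonicity of spanning trees at an ADJACENT pair, in the kernel)

Support file (`--supports stmt-CriticalPhenomena-4575`), FK sub-lane `prim-bschramm-fk-1` (generation 29) of the post-continuity
programme; builds on p205010 (kernel theorem, internal audit signed; external expert review pending).  No definitions, no named facts,
no sorries; standard axioms.  Part 4 of 4 (parts 1–3: `…ForestTreeLevelTools`, `…ForestTreeLevelPairCell`, `…ForestTreeLevelSteps`;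
the whole development checks as one scratch file).

THE NODE (`AdjForestRayleighNoSqOn`, (♣)⁰): on a fibre `(M, u₀)`, `#(Fo ∩ {e, f ∈ ω}, Fo) ≤ #(Fo ∩ {e ∈ ω}, Fo ∩ {f ∈ ω})` for `e = ov`,
`f = oy`, `v ≠ y`.  THIS FILE: **`treeLevel_of_farVertex`** (a far vertex `z ∉ {o,v,y}` of weighted degree `≤ 3` is eliminated, given
the inequality on `S ∖ {z}`: its pairs are read off the degree count and handed to the steps of part 3) and the theorem
**`adjForestNoSq_fibre_of_tight`**: the inequality holds on every fibre whose pairs lie inside a finite vertex set `S` with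
`2|S| ≤ |M| + 2|u₀| + 2` — on such a fibre both classes of every valid colouring are spanning trees of `S`, so this is the TREE LEVEL of
the node, i.e. the top square-free coefficient of CHLW's identity `T_e^f T_f^e − T_{ef} T^{ef} = (X⁺ − X⁻)²`, where for an ADJACENT pair
`X⁺ = 0` and the difference is the honest square `(X⁻)²` (false at non-adjacent pairs: `K₄`, `…ForestRayleighK4`).  The lineage used this
step at paper level (memo bschramm/FROM-fk-1-g18-VERTEX-NC.md §4c(i), "`U = V` tight ⇒ tree level"); corollary
`adjForestNoSq_fibre_of_tight_univ`.
PROOF: CHLW's induction restricted to adjacent pairs (no Case 4, no sign-reversing involution) — strong induction on `|S|`; diagonal /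
pinned / absent `e, f` and over-tight fibres are trivial; `Σ_{w ∈ S} deg w = 2W = 4|S| − 4` (`sum_card_filter_mem_eq`) gives a far vertex
of weighted degree `≤ 3` (`treeLevel_of_farVertex`) or `deg o + deg v + deg y ≤ 8`, in which case `deg o = 2` kills every valid colouring
through `e, f` and `deg v ≤ 2` (or `deg y ≤ 2`) is CHLW's Case 2(ii) (`treeLevel_of_lowEnd`).
[cite: CibulkaHladkyLaCroixWagner2008, Thm. 1 (p. 2), Cases 2–3 (pp. 4–5)] [cite: SempleWelsh2008, Conj. 1.1 (p. 2); Thm. 4.2 (p. 11)]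
[cite: Linusson2011, Prop. 2.6] [cite: Grimmett2006, §1.5 (p. 13)]
-/

noncomputable section

namespace Summit.CriticalPhenomena.PercolationContinuityZ3.Theorems
namespace FK

open MeasureTheory Set Literature.Probability.LatticeModels Literature.Probability.Percolation
open scoped Classical symmDiff

variable {V : Type*} [Fintype V]
/-! ### The far-vertex case -/

section Far

/-- **A far vertex of weighted degree at most three** (given the tree-level inequality on `S ∖ {z}`).
[cite: CibulkaHladkyLaCroixWagner2008, Thm. 1 (p. 2), Cases 0–3 (pp. 4–5)] [cite: Linusson2011, Prop. 2.6] -/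
theorem treeLevel_of_farVertex {M u₀ : BondConfig V} {S : Finset V} {o v y z : V}
    (IHT : ∀ (N u : BondConfig V), Disjoint u N → (∀ g ∈ N ∪ u, ∀ w ∈ g, w ∈ S.erase z) →
      2 * (S.erase z).card ≤ N.ncard + 2 * u.ncard + 2 →
      fibreCount N u (forestEv V ∩ {ω | s(o, v) ∈ ω ∧ s(o, y) ∈ ω}) (forestEv V) ≤
        fibreCount N u (forestEv V ∩ {ω | s(o, v) ∈ ω}) (forestEv V ∩ {ω | s(o, y) ∈ ω}))
    (hd : Disjoint u₀ M) (hS : ∀ g ∈ M ∪ u₀, ∀ w ∈ g, w ∈ S) (hdiag : ∀ g ∈ M ∪ u₀, ¬ g.IsDiag)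
    (heM : s(o, v) ∈ M) (hfM : s(o, y) ∈ M) (hvy : v ≠ y) (hWeq : M.ncard + 2 * u₀.ncard + 2 = 2 * S.card)
    (hzS : z ∈ S) (hzo : z ≠ o) (hzv : z ≠ v) (hzy : z ≠ y) (hoS : o ∈ S)
    (hdegz : ((toFinite M).toFinset.filter fun g => z ∈ g).card + 2 * ((toFinite u₀).toFinset.filter fun g => z ∈ g).card ≤ 3) :
    fibreCount M u₀ (forestEv V ∩ {ω | s(o, v) ∈ ω ∧ s(o, y) ∈ ω}) (forestEv V) ≤
      fibreCount M u₀ (forestEv V ∩ {ω | s(o, v) ∈ ω}) (forestEv V ∩ {ω | s(o, y) ∈ ω}) := by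
  have ht : 2 * S.card ≤ M.ncard + 2 * u₀.ncard + 2 := hWeq.symm.le
  have hMd : ∀ g ∈ M, ¬ g.IsDiag := fun g hg => hdiag g (Or.inl hg)
  have hUd : ∀ g ∈ u₀, ¬ g.IsDiag := fun g hg => hdiag g (Or.inr hg)
  have hcardE : (S.erase z).card + 1 = S.card := Finset.card_erase_add_one hzS
  -- supports one vertex down
  have hT_of : ∀ {N u : BondConfig V}, (∀ g ∈ N ∪ u, g ∈ M ∪ u₀) → (∀ g ∈ N ∪ u, z ∉ g) →
      ∀ g ∈ N ∪ u, ∀ w ∈ g, w ∈ S.erase z := fun hsub hz' g hg w hw =>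
    Finset.mem_erase.2 ⟨fun h => hz' g hg (h ▸ hw), hS g (hsub g hg) w hw⟩
  have memS : ∀ {x : V}, s(z, x) ∈ M ∪ u₀ → x ∈ S.erase z := fun {x} hx =>
    Finset.mem_erase.2 ⟨fun h => hdiag _ hx (Sym2.mk_isDiag_iff.2 h.symm), hS _ hx x (Sym2.mem_mk_right _ _)⟩
  have he_ne : ∀ x : V, s(z, x) ≠ s(o, v) := fun x => mk_ne_of_far hzo hzv
  have hf_ne : ∀ x : V, s(z, x) ≠ s(o, y) := fun x => mk_ne_of_far hzo hzy
  rcases Nat.lt_or_ge ((toFinite u₀).toFinset.filter fun g => z ∈ g).card 1 with hb0 | hb1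
  · -- no pinned pair at `z`
    have hzu := isolated_of_card_filter_eq_zero (M := u₀) (z := z) (by omega)
    rcases Nat.lt_or_ge ((toFinite M).toFinset.filter fun g => z ∈ g).card 1 with ha0 | ha1
    · -- isolated
      have hzM := isolated_of_card_filter_eq_zero (M := M) (z := z) (by omega)
      rw [treeLevel_bad_eq_zero_of_isolated hS ht (fun g hg => hg.elim (hzM g) (hzu g)) hzS hoS hzo]
      exact Nat.zero_le _
    rcases Nat.lt_or_ge ((toFinite M).toFinset.filter fun g => z ∈ g).card 2 with ha1' | ha2
    · -- one free pair
      obtain ⟨c, -, hzcM, honly⟩ := exists_of_card_filter_eq_one (z := z) hMd (by omega)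
      have hM : insert s(z, c) (M \ {s(z, c)}) = M := by rw [insert_sdiff_singleton, insert_eq_of_mem hzcM]
      have hz' : ∀ g ∈ M \ {s(z, c)} ∪ u₀, z ∉ g := fun g hg hzg =>
        hg.elim (fun hg => hg.2 (honly g hg.1 hzg)) (fun hg => hzu g hg hzg)
      have hS' : ∀ g ∈ insert s(z, c) (M \ {s(z, c)}) ∪ u₀, ∀ w ∈ g, w ∈ S := by rw [hM]; exact hS
      have ht' : 2 * S.card ≤ (insert s(z, c) (M \ {s(z, c)})).ncard + 2 * u₀.ncard + 2 := by rw [hM]; exact ht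
      have h0 := treeLevel_bad_eq_zero_of_degOne (o := o) (v := v) (y := y) hS' ht' hz' hzS hoS hzo
      rw [hM] at h0
      rw [h0]
      exact Nat.zero_le _
    rcases Nat.lt_or_ge ((toFinite M).toFinset.filter fun g => z ∈ g).card 3 with ha2' | ha3
    · -- two free pairs
      obtain ⟨a, b, hza, hzb, hab, haM, hbM, honly⟩ := exists_of_card_filter_eq_two (z := z) hMd (by omega)
      have hab' : s(z, a) ≠ s(z, b) := fun h => hab (Sym2.congr_right.1 h)
      have h1 : s(z, a) ∉ insert s(z, b) (M \ {s(z, a), s(z, b)}) := fun h => by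
        rcases mem_insert_iff.1 h with h | h
        · exact hab' h
        · exact h.2 (mem_insert _ _)
      have h2 : s(z, b) ∉ M \ {s(z, a), s(z, b)} := fun h => h.2 (Or.inr rfl)
      have hM : insert s(z, a) (insert s(z, b) (M \ {s(z, a), s(z, b)})) = M := by
        ext g
        simp only [mem_insert_iff, mem_sdiff, mem_singleton_iff]
        constructor
        · rintro (rfl | rfl | ⟨hg, -⟩) <;> assumption
        · intro hg
          by_cases h1 : g = s(z, a)
          · exact Or.inl h1
          by_cases h2 : g = s(z, b)
          · exact Or.inr (Or.inl h2)
          · exact Or.inr (Or.inr ⟨hg, fun h => h.elim h1 h2⟩)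
      have hz' : ∀ g ∈ M \ {s(z, a), s(z, b)} ∪ u₀, z ∉ g := fun g hg hzg =>
        hg.elim (fun hg => hg.2 (honly g hg.1 hzg)) (fun hg => hzu g hg hzg)
      have hd' : Disjoint u₀ (M \ {s(z, a), s(z, b)}) := hd.mono_right sdiff_subset
      have hT' := hT_of (N := M \ {s(z, a), s(z, b)}) (u := u₀)
        (fun g hg => hg.elim (fun h => Or.inl h.1) Or.inr) hz'
      have hcard : (insert s(z, a) (insert s(z, b) (M \ {s(z, a), s(z, b)}))).ncard = (M \ {s(z, a), s(z, b)}).ncard + 2 := by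
        rw [ncard_insert_of_notMem h1 (toFinite _), ncard_insert_of_notMem h2 (toFinite _)]
      rw [hM] at hcard
      have key := treeLevel_step_degTwo IHT hd' hz' hza hzb hab hzo hzv hzy hT' (memS (Or.inl haM)) (memS (Or.inl hbM))
        (by omega)
      rw [hM] at key
      exact key
    · -- three free pairs: the claw
      obtain ⟨a, b, c, hza, hzb, hzc, hab, hac, hbc, haM, hbM, hcM', honly⟩ :=
        exists_of_card_filter_eq_three (z := z) hMd (by omega)
      have hab' : s(z, a) ≠ s(z, b) := fun h => hab (Sym2.congr_right.1 h)
      have hac' : s(z, a) ≠ s(z, c) := fun h => hac (Sym2.congr_right.1 h)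
      have hbc' : s(z, b) ≠ s(z, c) := fun h => hbc (Sym2.congr_right.1 h)
      have h1 : s(z, a) ∉ insert s(z, b) (insert s(z, c) (M \ {s(z, a), s(z, b), s(z, c)})) := fun h => by
        rcases mem_insert_iff.1 h with h | h
        · exact hab' h
        rcases mem_insert_iff.1 h with h | h
        · exact hac' h
        · exact h.2 (mem_insert _ _)
      have h2 : s(z, b) ∉ insert s(z, c) (M \ {s(z, a), s(z, b), s(z, c)}) := fun h => by
        rcases mem_insert_iff.1 h with h | h
        · exact hbc' h
        · exact h.2 (mem_insert_of_mem _ (mem_insert _ _))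
      have h3 : s(z, c) ∉ M \ {s(z, a), s(z, b), s(z, c)} := fun h => h.2 (Or.inr (Or.inr rfl))
      have hM : insert s(z, a) (insert s(z, b) (insert s(z, c) (M \ {s(z, a), s(z, b), s(z, c)}))) = M := by
        ext g
        simp only [mem_insert_iff, mem_sdiff, mem_singleton_iff]
        constructor
        · rintro (rfl | rfl | rfl | ⟨hg, -⟩) <;> assumption
        · intro hg
          by_cases h1 : g = s(z, a)
          · exact Or.inl h1
          by_cases h2 : g = s(z, b)
          · exact Or.inr (Or.inl h2)
          by_cases h3 : g = s(z, c)
          · exact Or.inr (Or.inr (Or.inl h3))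
          · exact Or.inr (Or.inr (Or.inr ⟨hg, fun h => h.elim h1 (fun h => h.elim h2 h3)⟩))
      have hz' : ∀ g ∈ M \ {s(z, a), s(z, b), s(z, c)} ∪ u₀, z ∉ g := fun g hg hzg =>
        hg.elim (fun hg => hg.2 (honly g hg.1 hzg)) (fun hg => hzu g hg hzg)
      have hd' : Disjoint u₀ (M \ {s(z, a), s(z, b), s(z, c)}) := hd.mono_right sdiff_subset
      have hT' := hT_of (N := M \ {s(z, a), s(z, b), s(z, c)}) (u := u₀)
        (fun g hg => hg.elim (fun h => Or.inl h.1) Or.inr) hz'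
      have hcard : (insert s(z, a) (insert s(z, b) (insert s(z, c) (M \ {s(z, a), s(z, b), s(z, c)})))).ncard =
          (M \ {s(z, a), s(z, b), s(z, c)}).ncard + 3 := by
        rw [ncard_insert_of_notMem h1 (toFinite _), ncard_insert_of_notMem h2 (toFinite _), ncard_insert_of_notMem h3 (toFinite _)]
      rw [hM] at hcard
      have he' : s(o, v) ∈ M \ {s(z, a), s(z, b), s(z, c)} :=
        ⟨heM, fun h => by rcases h with h | h | h <;> exact he_ne _ h.symm⟩
      have hf' : s(o, y) ∈ M \ {s(z, a), s(z, b), s(z, c)} :=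
        ⟨hfM, fun h => by rcases h with h | h | h <;> exact hf_ne _ h.symm⟩
      have key := treeLevel_step_claw IHT hd' hz' hza hzb hzc hab hac hbc hzo hzv hzy hT' (memS (Or.inl haM))
        (memS (Or.inl hbM)) (memS (Or.inl hcM')) (by omega) he' hf' hvy
      rw [hM] at key
      exact key
  · -- one pinned pair at `z` (and at most one free pair)
    obtain ⟨h, hzh, hzhU, honlyU⟩ := exists_of_card_filter_eq_one (z := z) (M := u₀) hUd (by omega)
    have hU : insert s(z, h) (u₀ \ {s(z, h)}) = u₀ := by rw [insert_sdiff_singleton, insert_eq_of_mem hzhU]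
    have hUz : ∀ g ∈ u₀ \ {s(z, h)}, z ∉ g := fun g hg hzg => hg.2 (honlyU g hg.1 hzg)
    have hcardU : (insert s(z, h) (u₀ \ {s(z, h)})).ncard = (u₀ \ {s(z, h)}).ncard + 1 :=
      ncard_insert_of_notMem (fun h' => h'.2 rfl) (toFinite _)
    rw [hU] at hcardU
    rcases Nat.lt_or_ge ((toFinite M).toFinset.filter fun g => z ∈ g).card 1 with ha0 | ha1
    · -- pendant pinned pair
      have hzM := isolated_of_card_filter_eq_zero (M := M) (z := z) (by omega)
      have hz' : ∀ g ∈ M ∪ (u₀ \ {s(z, h)}), z ∉ g := fun g hg => hg.elim (hzM g) (hUz g)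
      have hd' : Disjoint (u₀ \ {s(z, h)}) M := hd.mono_left sdiff_subset
      have hT' := hT_of (N := M) (u := u₀ \ {s(z, h)}) (fun g hg => hg.elim Or.inl (fun h => Or.inr h.1)) hz'
      have key := treeLevel_step_pendant (o := o) (v := v) (y := y) IHT hd' hz' hzh hzo hzv hzy hT' (by omega)
      rw [hU] at key
      exact key
    · -- one free and one pinned pair
      obtain ⟨i, hzi, hziM, honlyM⟩ := exists_of_card_filter_eq_one (z := z) hMd (by omega)
      have hhi : h ≠ i := fun h' => Set.disjoint_left.1 hd hzhU (h' ▸ hziM)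
      have hM : insert s(z, i) (M \ {s(z, i)}) = M := by rw [insert_sdiff_singleton, insert_eq_of_mem hziM]
      have hcardM : (insert s(z, i) (M \ {s(z, i)})).ncard = (M \ {s(z, i)}).ncard + 1 :=
        ncard_insert_of_notMem (fun h' => h'.2 rfl) (toFinite _)
      rw [hM] at hcardM
      have hz' : ∀ g ∈ M \ {s(z, i)} ∪ (u₀ \ {s(z, h)}), z ∉ g := fun g hg hzg =>
        hg.elim (fun hg => hg.2 (honlyM g hg.1 hzg)) (fun hg => hUz g hg hzg)
      have hd' : Disjoint (u₀ \ {s(z, h)}) (M \ {s(z, i)}) := (hd.mono_left sdiff_subset).mono_right sdiff_subset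
      have hT' := hT_of (N := M \ {s(z, i)}) (u := u₀ \ {s(z, h)})
        (fun g hg => hg.elim (fun h => Or.inl h.1) (fun h => Or.inr h.1)) hz'
      have he' : s(o, v) ∈ M \ {s(z, i)} := ⟨heM, fun h' => he_ne _ h'.symm⟩
      have hf' : s(o, y) ∈ M \ {s(z, i)} := ⟨hfM, fun h' => hf_ne _ h'.symm⟩
      have key := treeLevel_step_mixed IHT hd' hz' hzh hzi hhi hzo hzv hzy hT' (memS (Or.inr hzhU)) (memS (Or.inl hziM))
        (by omega) he' hf' hvy
      rw [hM, hU] at key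
      exact key

end Far


/-! ### The tree-level theorem -/

section Main

/-- **THE TREE LEVEL, induction form** (strong induction on the size of the support `S`).
[cite: CibulkaHladkyLaCroixWagner2008, Thm. 1 (p. 2), Cases 2–3 (pp. 4–5)] [cite: Linusson2011, Prop. 2.6] -/
theorem adjForestNoSq_fibre_of_tight_aux (n : ℕ) : ∀ {M u₀ : BondConfig V} (S : Finset V) {o v y : V}, S.card = n →
    Disjoint u₀ M → v ≠ y → (∀ g ∈ M ∪ u₀, ∀ w ∈ g, w ∈ S) → 2 * S.card ≤ M.ncard + 2 * u₀.ncard + 2 →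
    fibreCount M u₀ (forestEv V ∩ {ω | s(o, v) ∈ ω ∧ s(o, y) ∈ ω}) (forestEv V) ≤
      fibreCount M u₀ (forestEv V ∩ {ω | s(o, v) ∈ ω}) (forestEv V ∩ {ω | s(o, y) ∈ ω}) := by
  induction n using Nat.strong_induction_on with
  | _ n IH =>
  intro M u₀ S o v y hn hd hvy hS ht
  have hu_sub : ∀ {ω : BondConfig V}, ω \ M = u₀ → u₀ ⊆ ω ∧ u₀ ⊆ ω ∆ M := fun {ω} hω =>
    ⟨fun x hx => by rw [← hω] at hx; exact hx.1, fun x hx => by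
      rw [← hω] at hx; exact Set.mem_symmDiff.2 (Or.inl ⟨hx.1, hx.2⟩)⟩
  -- 0. diagonal pairs: no valid colouring through them
  by_cases hdiag : ∃ g ∈ M ∪ u₀, g.IsDiag
  · obtain ⟨g, hg, hgd⟩ := hdiag
    rw [fibreCount_eq_zero_of_forall M u₀ _ _ fun ω hω hA hB => by
      rcases hg with hgM | hgu
      · by_cases hgω : g ∈ ω
        · exact hA.1.1 g hgω hgd
        · exact hB.1 g (Set.mem_symmDiff.2 (Or.inr ⟨hgM, hgω⟩)) hgd
      · exact hA.1.1 g ((hu_sub hω).1 hgu) hgd]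
    exact Nat.zero_le _
  push Not at hdiag
  have hMd : ∀ g ∈ M, ¬ g.IsDiag := fun g hg => hdiag g (Or.inl hg)
  have hUd : ∀ g ∈ u₀, ¬ g.IsDiag := fun g hg => hdiag g (Or.inr hg)
  -- 1. `e` and `f` are free pairs (otherwise `bad = 0` or `bad = good`)
  by_cases heM : s(o, v) ∈ M
  swap
  · by_cases heu : s(o, v) ∈ u₀
    · have h1 : fibreCount M u₀ (forestEv V ∩ {ω | s(o, v) ∈ ω ∧ s(o, y) ∈ ω}) (forestEv V) =
          fibreCount M u₀ (forestEv V ∩ {ω | s(o, y) ∈ ω}) (forestEv V) :=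
        fibreCount_congr_fibre _ _ fun ω hω => by
          have he : s(o, v) ∈ ω := (hu_sub hω).1 heu
          simp only [mem_inter_iff, mem_setOf_eq, he, true_and]
      have h2 : fibreCount M u₀ (forestEv V ∩ {ω | s(o, v) ∈ ω}) (forestEv V ∩ {ω | s(o, y) ∈ ω}) =
          fibreCount M u₀ (forestEv V) (forestEv V ∩ {ω | s(o, y) ∈ ω}) :=
        fibreCount_congr_fibre _ _ fun ω hω => by
          have he : s(o, v) ∈ ω := (hu_sub hω).1 heu
          simp only [mem_inter_iff, mem_setOf_eq, he, and_true]
      rw [h1, h2, fibreCount_swap]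
    · rw [fibreCount_eq_zero_of_forall M u₀ _ _ fun ω hω hA _ =>
        ((subset_union_of_fibre hω).1 hA.2.1).elim heM heu]
      exact Nat.zero_le _
  by_cases hfM : s(o, y) ∈ M
  swap
  · by_cases hfu : s(o, y) ∈ u₀
    · have h1 : fibreCount M u₀ (forestEv V ∩ {ω | s(o, v) ∈ ω ∧ s(o, y) ∈ ω}) (forestEv V) =
          fibreCount M u₀ (forestEv V ∩ {ω | s(o, v) ∈ ω}) (forestEv V) :=
        fibreCount_congr_fibre _ _ fun ω hω => by
          have hf : s(o, y) ∈ ω := (hu_sub hω).1 hfu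
          simp only [mem_inter_iff, mem_setOf_eq, hf, and_true]
      have h2 : fibreCount M u₀ (forestEv V ∩ {ω | s(o, v) ∈ ω}) (forestEv V ∩ {ω | s(o, y) ∈ ω}) =
          fibreCount M u₀ (forestEv V ∩ {ω | s(o, v) ∈ ω}) (forestEv V) :=
        fibreCount_congr_fibre _ _ fun ω hω => by
          have hf : s(o, y) ∈ ω ∆ M := (hu_sub hω).2 hfu
          simp only [mem_inter_iff, mem_setOf_eq, hf, and_true]
      rw [h1, h2]
    · rw [fibreCount_eq_zero_of_forall M u₀ _ _ fun ω hω hA _ =>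
        ((subset_union_of_fibre hω).1 hA.2.2).elim hfM hfu]
      exact Nat.zero_le _
  -- the three special vertices
  have hov : o ≠ v := fun h => hMd _ heM (Sym2.mk_isDiag_iff.2 h)
  have hoy : o ≠ y := fun h => hMd _ hfM (Sym2.mk_isDiag_iff.2 h)
  have hoS : o ∈ S := hS _ (Or.inl heM) o (Sym2.mem_mk_left _ _)
  have hvS : v ∈ S := hS _ (Or.inl heM) v (Sym2.mem_mk_right _ _)
  have hyS : y ∈ S := hS _ (Or.inl hfM) y (Sym2.mem_mk_right _ _)
  -- 2. over-tight fibres carry no valid colouring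
  by_cases hover : 2 * S.card + 1 ≤ M.ncard + 2 * u₀.ncard + 2
  · rw [fibreCount_eq_zero_of_forall M u₀ _ _ fun ω hω hA hB => by
      have h := card_image_add_of_fibre hS hω hA.1 hB
      have c1 : 1 ≤ (S.image (openGraph ω).connectedComponentMk).card := Finset.card_pos.2 ⟨_, Finset.mem_image_of_mem _ hoS⟩
      have c2 : 1 ≤ (S.image (openGraph (ω ∆ M)).connectedComponentMk).card := Finset.card_pos.2 ⟨_, Finset.mem_image_of_mem _ hoS⟩
      omega]
    exact Nat.zero_le _
  have hWeq : M.ncard + 2 * u₀.ncard + 2 = 2 * S.card := by omega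
  -- 3. degrees: `Σ_{w ∈ S} (dM w + 2 dU w) = 2|M| + 4|u₀| = 4|S| − 4`
  have hsumM := sum_card_filter_mem_eq (toFinite M).toFinset S (fun g hg => hMd g ((Set.Finite.mem_toFinset _).1 hg))
    (fun g hg w hw => hS g (Or.inl ((Set.Finite.mem_toFinset _).1 hg)) w hw)
  have hsumU := sum_card_filter_mem_eq (toFinite u₀).toFinset S (fun g hg => hUd g ((Set.Finite.mem_toFinset _).1 hg))
    (fun g hg w hw => hS g (Or.inr ((Set.Finite.mem_toFinset _).1 hg)) w hw)
  have hcM : (toFinite M).toFinset.card = M.ncard := (Set.ncard_eq_toFinset_card M (toFinite M)).symm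
  have hcU : (toFinite u₀).toFinset.card = u₀.ncard := (Set.ncard_eq_toFinset_card u₀ (toFinite u₀)).symm
  have hsum : ∑ w ∈ S, (((toFinite M).toFinset.filter fun g => w ∈ g).card +
      2 * ((toFinite u₀).toFinset.filter fun g => w ∈ g).card) = 2 * M.ncard + 4 * u₀.ncard := by
    rw [Finset.sum_add_distrib, ← Finset.mul_sum, hsumM, hsumU, hcM, hcU]; ring
  have hT3 : ({o, v, y} : Finset V).card = 3 := Finset.card_eq_three.2 ⟨o, v, y, hov, hoy, hvy, rfl⟩
  have hTS : ({o, v, y} : Finset V) ⊆ S := by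
    intro w hw
    simp only [Finset.mem_insert, Finset.mem_singleton] at hw
    rcases hw with rfl | rfl | rfl <;> assumption
  have hsplit := Finset.sum_sdiff hTS (f := fun w => ((toFinite M).toFinset.filter fun g => w ∈ g).card +
      2 * ((toFinite u₀).toFinset.filter fun g => w ∈ g).card)
  have hovy : o ∉ ({v, y} : Finset V) := by simp only [Finset.mem_insert, Finset.mem_singleton, not_or]; exact ⟨hov, hoy⟩
  rw [Finset.sum_insert hovy, Finset.sum_pair hvy] at hsplit
  have hcardST : (S \ {o, v, y}).card + 3 = S.card := by rw [← hT3]; exact Finset.card_sdiff_add_card_eq_card hTS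
  by_cases hfar : ∃ z ∈ S \ {o, v, y}, ((toFinite M).toFinset.filter fun g => z ∈ g).card +
      2 * ((toFinite u₀).toFinset.filter fun g => z ∈ g).card ≤ 3
  swap
  · -- 4. no far vertex of small degree: `deg o + deg v + deg y ≤ 8`
    push Not at hfar
    have h4 := Finset.card_nsmul_le_sum (S \ {o, v, y}) (fun w => ((toFinite M).toFinset.filter fun g => w ∈ g).card +
      2 * ((toFinite u₀).toFinset.filter fun g => w ∈ g).card) 4 (fun z hz => hfar z hz)
    rw [smul_eq_mul] at h4
    have hsmall : ((toFinite M).toFinset.filter fun g => o ∈ g).card + 2 * ((toFinite u₀).toFinset.filter fun g => o ∈ g).card +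
        (((toFinite M).toFinset.filter fun g => v ∈ g).card + 2 * ((toFinite u₀).toFinset.filter fun g => v ∈ g).card) +
        (((toFinite M).toFinset.filter fun g => y ∈ g).card + 2 * ((toFinite u₀).toFinset.filter fun g => y ∈ g).card) ≤ 8 := by
      omega
    have h2o := two_le_card_filter heM hfM hvy
    by_cases hdo : ((toFinite M).toFinset.filter fun g => o ∈ g).card + 2 * ((toFinite u₀).toFinset.filter fun g => o ∈ g).card ≤ 2
    · -- the hub has only `e, f`: `bad = 0` (the partner isolates `o`)
      have hUo := isolated_of_card_filter_eq_zero (M := u₀) (z := o) (by omega)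
      obtain ⟨a', b', -, -, hab, haM, hbM, honly⟩ := exists_of_card_filter_eq_two (z := o) hMd (by omega)
      have hef : s(o, v) ≠ s(o, y) := fun h' => hvy (Sym2.congr_right.1 h')
      have cover : ∀ g ∈ M, o ∈ g → g = s(o, v) ∨ g = s(o, y) := by
        intro g hg hog
        rcases honly _ heM (Sym2.mem_mk_left _ _) with he' | he' <;>
          rcases honly _ hfM (Sym2.mem_mk_left _ _) with hf' | hf' <;>
            rcases honly g hg hog with hg' | hg'
        · exact absurd (he'.trans hf'.symm) hef
        · exact absurd (he'.trans hf'.symm) hef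
        · exact Or.inl (hg'.trans he'.symm)
        · exact Or.inr (hg'.trans hf'.symm)
        · exact Or.inr (hg'.trans hf'.symm)
        · exact Or.inl (hg'.trans he'.symm)
        · exact absurd (he'.trans hf'.symm) hef
        · exact absurd (he'.trans hf'.symm) hef
      rw [fibreCount_eq_zero_of_forall M u₀ _ _ fun ω hω hA hB => by
        have hiso : ∀ g ∈ ω ∆ M, o ∉ g := fun g hg hog => by
          rcases (subset_union_of_fibre hω).2 hg with hgM | hgu
          · rcases cover g hgM hog with rfl | rfl
            · exact (mem_symmDiff_iff_not_mem heM).1 hg hA.2.1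
            · exact (mem_symmDiff_iff_not_mem hfM).1 hg hA.2.2
          · exact hUo g hgu hog
        exact not_reachable_of_isolated hiso hov.symm (reachable_symmDiff_of_tight hS ht hω hA.1 hB hoS hvS)]
      exact Nat.zero_le _
    · -- an end of degree at most two
      by_cases hdv : ((toFinite M).toFinset.filter fun g => v ∈ g).card + 2 * ((toFinite u₀).toFinset.filter fun g => v ∈ g).card ≤ 2
      · exact treeLevel_of_lowEnd hS ht hdiag heM hov hvy hoS hvS hdv
      · have hdy : ((toFinite M).toFinset.filter fun g => y ∈ g).card +
            2 * ((toFinite u₀).toFinset.filter fun g => y ∈ g).card ≤ 2 := by omega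
        have key := treeLevel_of_lowEnd (v := y) (y := v) hS ht hdiag hfM hoy hvy.symm hoS hyS hdy
        have hset : {ω : BondConfig V | s(o, y) ∈ ω ∧ s(o, v) ∈ ω} = {ω | s(o, v) ∈ ω ∧ s(o, y) ∈ ω} := by
          ext ω; simp only [mem_setOf_eq]; tauto
        rw [hset, fibreCount_swap M u₀ (forestEv V ∩ {ω | s(o, y) ∈ ω})] at key
        exact key
  -- 5. a far vertex `z` of weighted degree at most three
  obtain ⟨z, hz, hdegz⟩ := hfar
  have hzS : z ∈ S := (Finset.mem_sdiff.1 hz).1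
  have hzT : z ∉ ({o, v, y} : Finset V) := (Finset.mem_sdiff.1 hz).2
  simp only [Finset.mem_insert, Finset.mem_singleton, not_or] at hzT; obtain ⟨hzo, hzv, hzy⟩ := hzT
  have hcardE : (S.erase z).card + 1 = S.card := Finset.card_erase_add_one hzS
  exact treeLevel_of_farVertex (fun N u hd' hS' ht' => IH (S.erase z).card (by omega) (S.erase z) rfl hd' hvy hS' ht')
    hd hS hdiag heM hfM hvy hWeq hzS hzo hzv hzy hoS hdegz

/-- **THE TREE LEVEL OF THE SQUARE-FREE ADJACENT FOREST RAYLEIGH NODE.**  On every fibre `(M, u₀)` (`Disjoint u₀ M`) whose pairs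
lie inside a finite vertex set `S` with `2|S| ≤ |M| + 2|u₀| + 2` — every valid colouring consists of two spanning trees of `S` —
the node's inequality holds: `#(Fo ∩ {e, f ∈ ω}, Fo) ≤ #(Fo ∩ {e ∈ ω}, Fo ∩ {f ∈ ω})` for `e = ov`, `f = oy`, `v ≠ y`.  This is
Cibulka–Hladký–LaCroix–Wagner's coefficientwise Rayleigh monotonicity of spanning trees at an ADJACENT pair (`X⁺ = 0`, so
`T_e^f T_f^e − T_{ef} T^{ef} = (X⁻)²` has nonnegative coefficients), in the lineage's fibre language.
[cite: CibulkaHladkyLaCroixWagner2008, Thm. 1 (p. 2)] [cite: SempleWelsh2008, Conj. 1.1 (p. 2)] [cite: Linusson2011, Prop. 2.6] -/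
theorem adjForestNoSq_fibre_of_tight {M u₀ : BondConfig V} (S : Finset V) {o v y : V} (hd : Disjoint u₀ M) (hvy : v ≠ y)
    (hS : ∀ g ∈ M ∪ u₀, ∀ w ∈ g, w ∈ S) (ht : 2 * S.card ≤ M.ncard + 2 * u₀.ncard + 2) :
    fibreCount M u₀ (forestEv V ∩ {ω | s(o, v) ∈ ω ∧ s(o, y) ∈ ω}) (forestEv V) ≤
      fibreCount M u₀ (forestEv V ∩ {ω | s(o, v) ∈ ω}) (forestEv V ∩ {ω | s(o, y) ∈ ω}) :=
  adjForestNoSq_fibre_of_tight_aux S.card S rfl hd hvy hS ht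

/-- **Tree level, whole vertex type**: if `2|V| ≤ |M| + 2|u₀| + 2` then the node's inequality holds on `(M, u₀)` for every hub
and every adjacent pair — e.g. every fibre of a `(2,2)`-tight multigraph such as `K₄`, the wheels, or any edge-disjoint union of two
spanning trees. [cite: CibulkaHladkyLaCroixWagner2008, Thm. 1 (p. 2)] [cite: SempleWelsh2008, Conj. 1.1 (p. 2)] -/
theorem adjForestNoSq_fibre_of_tight_univ {M u₀ : BondConfig V} {o v y : V} (hd : Disjoint u₀ M) (hvy : v ≠ y)
    (ht : 2 * Fintype.card V ≤ M.ncard + 2 * u₀.ncard + 2) :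
    fibreCount M u₀ (forestEv V ∩ {ω | s(o, v) ∈ ω ∧ s(o, y) ∈ ω}) (forestEv V) ≤
      fibreCount M u₀ (forestEv V ∩ {ω | s(o, v) ∈ ω}) (forestEv V ∩ {ω | s(o, y) ∈ ω}) :=
  adjForestNoSq_fibre_of_tight Finset.univ hd hvy (fun _ _ _ _ => Finset.mem_univ _) (by rwa [Finset.card_univ])

end Main

end FK
end Summit.CriticalPhenomena.PercolationContinuityZ3.Theorems

end
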